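import Summits.ValiantsHypothesis.ValiantsHypothesis.Theorems.BarrierLeverAnchoredDoorHitsLowerPairsDecrementGeneralDefs

/-!
# Support item `AnchoredDoorHitsLowerPairs` (stmt-ValiantsHypothesis-22510), line `anchored-peeling`:
# THE DECREMENT CERTIFICATE FOR GENERAL `k` — ROWS OF THE FAMILY, THE OWNER MAP INVERTS THE DESIGNATED TRIPLE, KEY INJECTIVITY, CLASSIFICATION OF COLUMNS

Helper file (`--supports stmt-ValiantsHypothesis-22510`; cell valiant-natproofs, rung V4, 𝒟-side door (c); registered line
`Cruxes/AnchoredDoorHitsLowerPairs/Lines/anchored_peeling.lean` v20, registered stub `Stmt.stub_decrementFamily` (CONJECTURE DC, `…DecrementFamily`,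
p650456); prover seat val-np-p1 gen 23; memo HOME/val-np-p1/g22/MEMO-relapex-valnp1-g22.md §12–§15 = the paper proof being formalised; definitions in
`…DecrementGeneralDefs` (p652973)). Closes NO item by itself; part of the kernel proof of `theorem stub_decrementFamily` (`…DecrementGeneral`).

WHAT. (§6 of the development.) `decRow_rowOf` / `decode_of_decRow` (rows of `DecRow k h` as `rowOf S e T`), `decRow_dRow` (designated rows are rows of the
family), `own_dtrip` (**the owner map inverts the designated triple** on valid descriptors) and `eq_of_dRow_eq` (designated rows determine their column),
`tup_lt_radix` / `eq_of_key_eq` / `key_lt_key` (the packed lexicographic key is injective on valid descriptors and compares lexicographically),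
`exists_col_of_decCol` (**every column of `DecCol k h` is `colOf` of a valid descriptor** — the nine column types).

WHAT THIS IS NOT: nothing on crux stmt-ValiantsHypothesis-14610 or on `VP` versus `VNP`.
-/

set_option linter.dupNamespace false

namespace Summit.ValiantsHypothesis.ValiantsHypothesis.Theorems.BarrierLever.AnchoredPeeling

namespace DecFamily

open Finset

variable {h : ℕ}

/-! ## 6. Rows of the family, the owner map inverts the designated triple, key bounds and injectivity, classification of columns -/

section Owner

variable {k : ℕ}

/-- `bits n ≠ ∅` for `n ≥ 1`. -/
theorem bits_ne_empty {n : ℕ} (hn : 1 ≤ n) : bits n ≠ ∅ := fun h0 => by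
  have := bits_eq_empty_iff.mp h0; omega

/-- `enc (range k) + 1 = 2^k`. -/
theorem enc_range (k : ℕ) : enc (range k) + 1 = 2 ^ k := by
  induction k with
  | zero => simp [enc]
  | succ k ih =>
    unfold enc at ih ⊢
    rw [Finset.sum_range_succ, pow_succ]
    omega

/-- A proper index subset of `range k` has value `< 2^k − 1`. -/
theorem enc_add_one_lt_two_pow {S : Finset ℕ} (hS : S ⊆ range k) (hne : S ≠ range k) : enc S + 1 < 2 ^ k := by
  have := enc_lt_enc_of_ssubset (lt_of_le_of_ne hS hne)
  have := enc_range k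
  omega

/-! ### The owner map on explicit arguments -/

/-- Owner of `(∅,0,∅)`. -/
theorem own_empty : own ∅ false ∅ = .empty := by simp [own]
/-- Owner of `(S,0,∅)`. -/
theorem own_gam {S : Finset ℕ} (hS : S ≠ ∅) : own S false ∅ = .gam (enc S) := by simp [own, hS]
/-- Owner of `(∅,0,T)`. -/
theorem own_del {T : Finset ℕ} (hT : T ≠ ∅) : own ∅ false T = .del (enc T) := by simp [own, hT]
/-- Owner of `(S,0,T)`. -/
theorem own_cross {S T : Finset ℕ} (hS : S ≠ ∅) (hT : T ≠ ∅) : own S false T = .cross (enc S) (enc T) := by simp [own, hS, hT]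
/-- Owner of `(∅,1,∅)`. -/
theorem own_om : own ∅ true ∅ = .om := by simp [own]
/-- Owner of `(S,1,∅)`. -/
theorem own_omGam {S : Finset ℕ} (hS : S ≠ ∅) : own S true ∅ = .omGam (enc S) := by simp [own, hS]
/-- Owner of `(∅,1,T)`. -/
theorem own_omDel {T : Finset ℕ} (hT : T ≠ ∅) : own ∅ true T = .omDel (enc T) := by simp [own, hT]
/-- Owner of an E-row `(S,1,T)` with `S < T`. -/
theorem own_gg {S T : Finset ℕ} (hS : S ≠ ∅) (hT : T ≠ ∅) (hlt : enc S < enc T) : own S true T = .gg (enc S) (enc T) := by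
  simp [own, hS, hT, hlt]
/-- Owner of an E-row `(S,1,T)` with `T ≤ S`. -/
theorem own_dd {S T : Finset ℕ} (hS : S ≠ ∅) (hT : T ≠ ∅) (hle : enc T ≤ enc S) : own S true T = .dd (enc T) (enc S + 1) := by
  simp [own, hS, hT, not_lt.mpr hle]

/-- **The owner map inverts the designated triple** (on valid descriptors). -/
theorem own_dtrip {d : Col} (hd : d.Valid k) : own d.dtrip.1 d.dtrip.2.1 d.dtrip.2.2 = d := by
  cases d with
  | empty => exact own_empty
  | om => exact own_om
  | gam P =>
    obtain ⟨h1, _⟩ := hd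
    simp only [Col.dtrip]; rw [own_gam (bits_ne_empty h1), enc_bits]
  | del Q =>
    obtain ⟨h1, _⟩ := hd
    simp only [Col.dtrip]; rw [own_del (bits_ne_empty h1), enc_bits]
  | omGam P =>
    obtain ⟨h1, _⟩ := hd
    simp only [Col.dtrip]; rw [own_omGam (bits_ne_empty h1), enc_bits]
  | omDel Q =>
    obtain ⟨h1, _⟩ := hd
    simp only [Col.dtrip]; rw [own_omDel (bits_ne_empty h1), enc_bits]
  | cross P Q =>
    obtain ⟨h1, _, h3, _⟩ := hd
    simp only [Col.dtrip]; rw [own_cross (bits_ne_empty h1) (bits_ne_empty h3), enc_bits, enc_bits]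
  | gg P P' =>
    obtain ⟨h1, h2, _⟩ := hd
    simp only [Col.dtrip]
    rw [own_gg (bits_ne_empty h1) (bits_ne_empty (by omega)) (by rw [enc_bits, enc_bits]; exact h2), enc_bits, enc_bits]
  | dd Q Q' =>
    obtain ⟨h1, h2, _⟩ := hd
    simp only [Col.dtrip]
    rw [own_dd (bits_ne_empty (by omega)) (bits_ne_empty h1) (by rw [enc_bits, enc_bits]; omega), enc_bits, enc_bits]
    congr 1; omega

/-! ### Rows of the family `DecRow` in terms of `rowOf` -/

/-- A `rowOf` with `b`-indices in `range k` lives on the variables `≤ 2k`. -/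
theorem le_of_mem_rowOf {S T : Finset ℕ} {e : Bool} (hT : T ⊆ range k) {x : Fin h} (hx : x ∈ rowOf k S e T) : x.val ≤ 2 * k := by
  rcases mem_rowOf.mp hx with ⟨h1, _⟩ | ⟨h2, _⟩ | ⟨h3, h4⟩
  · omega
  · omega
  · have := mem_range.mp (hT h4); omega

/-- **`rowOf S e T` is a row of the family** unless it is an excluded top face `(A, 1, T ≠ ∅)`. -/
theorem decRow_rowOf {S T : Finset ℕ} {e : Bool} (hS : S ⊆ range k) (hT : T ⊆ range k) (hkh : 2 * k + 1 ≤ h)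
    (hex : S ≠ range k ∨ e = false ∨ T = ∅) : DecRow k h (rowOf k S e T) := by
  refine ⟨fun x hx => le_of_mem_rowOf hT hx, ?_⟩
  rintro ⟨hall, x, hx, hkx⟩
  rcases hex with hS' | he | hT'
  · apply hS'
    refine subset_antisymm hS (fun j hj => ?_)
    have hjk := mem_range.mp hj
    have := hall ⟨j, by omega⟩ (by simp only []; omega)
    rcases mem_rowOf.mp this with ⟨_, h1⟩ | ⟨h2, _⟩ | ⟨h3, _⟩
    · exact h1
    · simp only [] at h2; omega
    · simp only [] at h3; omega
  · have := hall ⟨k, by omega⟩ (by simp)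
    rcases mem_rowOf.mp this with ⟨h1, _⟩ | ⟨_, h2⟩ | ⟨h3, _⟩
    · simp only [] at h1; omega
    · rw [he] at h2; exact Bool.false_ne_true h2
    · simp only [] at h3; omega
  · rcases mem_rowOf.mp hx with ⟨h1, _⟩ | ⟨h2, _⟩ | ⟨_, h4⟩
    · omega
    · omega
    · rw [hT'] at h4; exact absurd h4 (Finset.notMem_empty _)

/-- **A row of the family decodes to index sets in `range k`, not of the excluded shape.** -/
theorem decode_of_decRow {U : Finset (Fin h)} (hU : DecRow k h U) :
    aIdx k U ⊆ range k ∧ bIdx k U ⊆ range k ∧ (aIdx k U ≠ range k ∨ eBit k U = false ∨ bIdx k U = ∅) := by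
  refine ⟨aIdx_subset_range k U, bIdx_subset_range hU.1, ?_⟩
  by_cases hA : aIdx k U = range k
  · by_cases hE : eBit k U = false
    · exact Or.inr (Or.inl hE)
    · right; right
      by_contra hB
      apply hU.2
      constructor
      · intro i hi
        rcases Nat.lt_or_eq_of_le hi with hlt | heq
        · have : i.val ∈ aIdx k U := by rw [hA]; exact mem_range.mpr hlt
          obtain ⟨_, x, hx, hxi⟩ := mem_aIdx.mp this
          rw [← Fin.ext hxi]; exact hx
        · have hE' : eBit k U = true := by cases h' : eBit k U <;> simp_all
          obtain ⟨x, hx, hxk⟩ := eBit_eq_true_iff.mp hE'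
          have hxi : x = i := Fin.ext (by rw [hxk, heq])
          rw [← hxi]; exact hx
      · obtain ⟨j, hj⟩ := Finset.nonempty_iff_ne_empty.mpr hB
        obtain ⟨x, hx, hxj⟩ := mem_bIdx.mp hj
        exact ⟨x, hx, by omega⟩
  · exact Or.inl hA

/-- **The designated row of a valid column is a row of the family.** -/
theorem decRow_dRow {d : Col} (hd : d.Valid k) (hk : 1 ≤ k) (hkh : 2 * k + 1 ≤ h) : DecRow k h (dRow (h := h) k d) := by
  have hr : ∀ {n : ℕ}, n < 2 ^ k → bits n ⊆ range k := fun hn => bits_subset_range hn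
  have hne : (∅ : Finset ℕ) ≠ range k := by
    intro h0; have := (Finset.ext_iff.mp h0 0).mpr (mem_range.mpr hk); simp at this
  cases d with
  | empty => exact decRow_rowOf (empty_subset _) (empty_subset _) hkh (Or.inr (Or.inl rfl))
  | om => exact decRow_rowOf (empty_subset _) (empty_subset _) hkh (Or.inr (Or.inr rfl))
  | gam P => exact decRow_rowOf (hr hd.2) (empty_subset _) hkh (Or.inr (Or.inl rfl))
  | del Q => exact decRow_rowOf (empty_subset _) (hr hd.2) hkh (Or.inr (Or.inl rfl))
  | omGam P => exact decRow_rowOf (hr hd.2) (empty_subset _) hkh (Or.inr (Or.inr rfl))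
  | omDel Q => exact decRow_rowOf (empty_subset _) (hr hd.2) hkh (Or.inl hne)
  | cross P Q => exact decRow_rowOf (hr hd.2.1) (hr hd.2.2.2) hkh (Or.inr (Or.inl rfl))
  | gg P P' =>
    obtain ⟨_, h2, h3⟩ := hd
    refine decRow_rowOf (hr (lt_trans h2 h3)) (hr h3) hkh (Or.inl fun heq => ?_)
    have : enc (bits P') ≤ enc (bits P) := enc_le_enc_of_subset (by
      simp only [Col.dtrip] at heq; rw [heq]; exact hr h3)
    rw [enc_bits, enc_bits] at this; omega
  | dd Q Q' =>
    obtain ⟨_, h2, h3⟩ := hd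
    refine decRow_rowOf (hr (by omega)) (hr (lt_trans h2 h3)) hkh (Or.inl fun heq => ?_)
    have : enc (bits Q') ≤ enc (bits (Q' - 1)) := enc_le_enc_of_subset (by
      simp only [Col.dtrip] at heq; rw [heq]; exact hr h3)
    rw [enc_bits, enc_bits] at this; omega

/-- Both index sets of a designated triple lie in `range k`. -/
theorem dtrip_subset_range {d : Col} (hd : d.Valid k) : d.dtrip.1 ⊆ range k ∧ d.dtrip.2.2 ⊆ range k := by
  have hr : ∀ {n : ℕ}, n < 2 ^ k → bits n ⊆ range k := fun hn => bits_subset_range hn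
  cases d with
  | empty => exact ⟨empty_subset _, empty_subset _⟩
  | om => exact ⟨empty_subset _, empty_subset _⟩
  | gam P => exact ⟨hr hd.2, empty_subset _⟩
  | del Q => exact ⟨empty_subset _, hr hd.2⟩
  | omGam P => exact ⟨hr hd.2, empty_subset _⟩
  | omDel Q => exact ⟨empty_subset _, hr hd.2⟩
  | cross P Q => exact ⟨hr hd.2.1, hr hd.2.2.2⟩
  | gg P P' => exact ⟨hr (lt_trans hd.2.1 hd.2.2), hr hd.2.2⟩
  | dd Q Q' => exact ⟨hr (by have := hd.2.2; omega), hr (lt_trans hd.2.1 hd.2.2)⟩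

/-- **Designated rows determine their column**: `dRow` is injective on valid descriptors. -/
theorem eq_of_dRow_eq {d d' : Col} (hd : d.Valid k) (hd' : d'.Valid k) (hkh : 2 * k + 1 ≤ h) (heq : dRow (h := h) k d = dRow k d') : d = d' := by
  have h1 := congrArg (aIdx k) heq
  have h2 := congrArg (eBit k) heq
  have h3 := congrArg (bIdx k) heq
  simp only [dRow] at h1 h2 h3
  rw [aIdx_rowOf (dtrip_subset_range hd).1 hkh, aIdx_rowOf (dtrip_subset_range hd').1 hkh] at h1
  rw [eBit_rowOf hkh, eBit_rowOf hkh] at h2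
  rw [bIdx_rowOf (dtrip_subset_range hd).2 hkh, bIdx_rowOf (dtrip_subset_range hd').2 hkh] at h3
  rw [← own_dtrip hd, ← own_dtrip hd', h1, h2, h3]

/-! ### Key bounds and injectivity -/

/-- Numbers `≤ 2^k` are below the radix. -/
theorem lt_radix_of_le {n : ℕ} (hn : n ≤ 2 ^ k) : n < radix k := by
  have := Nat.one_le_two_pow (n := k); unfold radix; omega

/-- `bits n` has at most `k` elements for `n < 2^k`. -/
theorem card_bits_le {n : ℕ} (hn : n < 2 ^ k) : (bits n).card ≤ k := by
  simpa using Finset.card_le_card (bits_subset_range hn)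

/-- Popcount components are below the radix. -/
theorem two_mul_card_add_one_lt_radix {S : Finset ℕ} (hS : S ⊆ range k) : 2 * S.card + 1 < radix k := by
  have h1 : S.card ≤ k := by simpa using Finset.card_le_card hS
  have h2 : k < 2 ^ k := Nat.lt_two_pow_self
  unfold radix; omega

/-- **Key components of a valid descriptor are below the radix.** -/
theorem tup_lt_radix {d : Col} (hd : d.Valid k) : d.tup.2.1 < radix k ∧ d.tup.2.2.1 < radix k ∧ d.tup.2.2.2 < radix k := by
  have h0 : 0 < radix k := by unfold radix; positivity
  have h1 : 1 < radix k := by unfold radix; have := Nat.one_le_two_pow (n := k); omega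
  cases d with
  | empty => exact ⟨h0, h0, h0⟩
  | om => exact ⟨h0, h0, h0⟩
  | gam P => exact ⟨h0, lt_radix_of_le hd.2.le, h0⟩
  | del Q => exact ⟨h1, lt_radix_of_le hd.2.le, h0⟩
  | omGam P => exact ⟨h0, lt_radix_of_le hd.2.le, h0⟩
  | omDel Q => exact ⟨h1, lt_radix_of_le hd.2.le, h0⟩
  | cross P Q => exact ⟨lt_radix_of_le hd.2.1.le, lt_radix_of_le hd.2.2.2.le, h0⟩
  | gg P P' =>
    obtain ⟨_, h2, h3⟩ := hd
    exact ⟨lt_radix_of_le (show P ≤ 2 ^ k by omega), two_mul_card_add_one_lt_radix (bits_subset_range h3), lt_radix_of_le h3.le⟩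
  | dd Q Q' =>
    obtain ⟨_, h2, h3⟩ := hd
    refine ⟨lt_radix_of_le (show Q ≤ 2 ^ k by omega), ?_, lt_radix_of_le h3.le⟩
    have := two_mul_card_add_one_lt_radix (k := k) (bits_subset_range (n := Q' - 1) (by omega))
    show 2 * (bits (Q' - 1)).card < radix k
    omega

/-- **The 4-tuple determines the descriptor.** -/
theorem eq_of_tup_eq {d d' : Col} (heq : d.tup = d'.tup) : d = d' := by
  cases d <;> cases d' <;> simp_all [Col.tup] <;> omega

/-- **The key is injective on valid descriptors.** -/
theorem eq_of_key_eq {d d' : Col} (hd : d.Valid k) (hd' : d'.Valid k) (heq : d.key k = d'.key k) : d = d' := by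
  obtain ⟨a1, a2, a3⟩ := tup_lt_radix hd
  obtain ⟨b1, b2, b3⟩ := tup_lt_radix hd'
  obtain ⟨e1, e2, e3, e4⟩ := tk_inj a1 a2 a3 b1 b2 b3 heq
  exact eq_of_tup_eq (Prod.ext e1 (Prod.ext e2 (Prod.ext e3 e4)))

/-- **Key comparison from the lexicographic comparison of the tuples** (components of the smaller side and the third component of the larger side bounded). -/
theorem key_lt_key {d d' : Col} (h1 : d.tup.2.1 < radix k) (h2 : d.tup.2.2.1 < radix k) (h3 : d.tup.2.2.2 < radix k) (h2' : d'.tup.2.2.1 < radix k)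
    (hlex : d.tup.1 < d'.tup.1 ∨ (d.tup.1 = d'.tup.1 ∧ (d.tup.2.1 < d'.tup.2.1 ∨ (d.tup.2.1 = d'.tup.2.1 ∧
      (d.tup.2.2.1 < d'.tup.2.2.1 ∨ (d.tup.2.2.1 = d'.tup.2.2.1 ∧ d.tup.2.2.2 < d'.tup.2.2.2)))))) : d.key k < d'.key k :=
  tk_lt_tk h1 h2 h3 h2' hlex

/-! ### Classification of the columns `DecCol` -/

/-- A singleton vertex-number set gives a singleton column. -/
theorem colOf_eq_singleton {d : Col} {c : ℕ} (hc : 1 ≤ c) (hch : c ≤ h) (hv : d.verts k = {c}) :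
    colOf k d = {(⟨c - 1, by omega⟩ : Fin h)} := by
  ext v
  rw [mem_colOf, hv, Finset.mem_singleton, Finset.mem_singleton, Fin.ext_iff]
  simp only []
  omega

/-- A two-element vertex-number set gives a two-element column. -/
theorem colOf_eq_pair {d : Col} {c c' : ℕ} (hc : 1 ≤ c) (hch : c ≤ h) (hc' : 1 ≤ c') (hch' : c' ≤ h) (hv : d.verts k = {c, c'}) :
    colOf k d = {(⟨c - 1, by omega⟩ : Fin h), (⟨c' - 1, by omega⟩ : Fin h)} := by
  ext v
  rw [mem_colOf, hv, Finset.mem_insert, Finset.mem_singleton, Finset.mem_insert, Finset.mem_singleton, Fin.ext_iff, Fin.ext_iff]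
  simp only []
  omega

/-- **Every column of the family is `colOf` of a valid descriptor.** -/
theorem exists_col_of_decCol {W : Finset (Fin h)} (hW : DecCol k h W) : ∃ d : Col, d.Valid k ∧ colOf k d = W := by
  obtain ⟨hbd, hcard⟩ := hW
  have hpow : 2 ^ (k + 1) = 2 * 2 ^ k := by rw [pow_succ]; ring
  rcases Nat.lt_or_ge W.card 1 with h0 | h1
  · rw [Nat.lt_one_iff, Finset.card_eq_zero] at h0
    subst h0
    refine ⟨.empty, trivial, ?_⟩
    ext v; simp [colOf, Col.verts]
  rcases Nat.lt_or_ge W.card 2 with h1' | h2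
  · obtain ⟨v, rfl⟩ := Finset.card_eq_one.mp (show W.card = 1 by omega)
    have hv := hbd v (Finset.mem_singleton_self v)
    have hvh := v.isLt
    rcases lt_trichotomy (v.val + 1) (2 ^ k) with hlt | heq | hgt
    · refine ⟨.gam (v.val + 1), ⟨by omega, hlt⟩, ?_⟩
      rw [colOf_eq_singleton (c := v.val + 1) (by omega) (by omega) rfl]
      congr 1
    · refine ⟨.om, trivial, ?_⟩
      rw [colOf_eq_singleton (c := 2 ^ k) Nat.one_le_two_pow (by omega) rfl]
      congr 1; exact Fin.ext (by simp only []; omega)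
    · refine ⟨.del (v.val + 1 - 2 ^ k), ⟨by omega, by omega⟩, ?_⟩
      rw [colOf_eq_singleton (c := 2 ^ k + (v.val + 1 - 2 ^ k)) (by omega) (by omega) rfl]
      congr 1; exact Fin.ext (by simp only []; omega)
  · obtain ⟨x, y, hxy, rfl⟩ := Finset.card_eq_two.mp (le_antisymm hcard h2)
    clear hcard h1 h2
    -- order the two vertices
    wlog hlt : x.val < y.val generalizing x y
    · have hyx : y.val < x.val := lt_of_le_of_ne (not_lt.mp hlt) (fun he => hxy (Fin.ext he).symm)
      obtain ⟨d, hd, hdW⟩ := this y x hxy.symm (by rwa [Finset.pair_comm]) hyx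
      exact ⟨d, hd, by rw [hdW, Finset.pair_comm]⟩
    have hx := hbd x (by simp)
    have hy := hbd y (by simp)
    have hxh := x.isLt
    have hyh := y.isLt
    have key : ∀ (c c' : ℕ) (hc : 1 ≤ c) (hch : c ≤ h) (hc' : 1 ≤ c') (hch' : c' ≤ h), c = x.val + 1 → c' = y.val + 1 →
        ({(⟨c - 1, by omega⟩ : Fin h), (⟨c' - 1, by omega⟩ : Fin h)} : Finset (Fin h)) = {x, y} := by
      intro c c' hc hch hc' hch' h1 h2
      subst h1 h2
      congr 1
    rcases lt_trichotomy (y.val + 1) (2 ^ k) with hylt | hyeq | hygt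
    · refine ⟨.gg (x.val + 1) (y.val + 1), ⟨by omega, by omega, hylt⟩, ?_⟩
      rw [colOf_eq_pair (c := x.val + 1) (c' := y.val + 1) (by omega) (by omega) (by omega) (by omega) rfl]
      exact key _ _ (by omega) (by omega) (by omega) (by omega) rfl rfl
    · refine ⟨.omGam (x.val + 1), ⟨by omega, by omega⟩, ?_⟩
      rw [colOf_eq_pair (c := x.val + 1) (c' := 2 ^ k) (by omega) (by omega) Nat.one_le_two_pow (by omega) rfl]
      exact key _ _ (by omega) (by omega) (by omega) (by omega) rfl (by omega)
    · rcases lt_trichotomy (x.val + 1) (2 ^ k) with hxlt | hxeq | hxgt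
      · refine ⟨.cross (x.val + 1) (y.val + 1 - 2 ^ k), ⟨by omega, hxlt, by omega, by omega⟩, ?_⟩
        rw [colOf_eq_pair (c := x.val + 1) (c' := 2 ^ k + (y.val + 1 - 2 ^ k)) (by omega) (by omega) (by omega) (by omega) rfl]
        exact key _ _ (by omega) (by omega) (by omega) (by omega) rfl (by omega)
      · refine ⟨.omDel (y.val + 1 - 2 ^ k), ⟨by omega, by omega⟩, ?_⟩
        rw [colOf_eq_pair (c := 2 ^ k) (c' := 2 ^ k + (y.val + 1 - 2 ^ k)) Nat.one_le_two_pow (by omega) (by omega) (by omega) rfl]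
        exact key _ _ (by omega) (by omega) (by omega) (by omega) (by omega) (by omega)
      · refine ⟨.dd (x.val + 1 - 2 ^ k) (y.val + 1 - 2 ^ k), ⟨by omega, by omega, by omega⟩, ?_⟩
        rw [colOf_eq_pair (c := 2 ^ k + (x.val + 1 - 2 ^ k)) (c' := 2 ^ k + (y.val + 1 - 2 ^ k)) (by omega) (by omega) (by omega) (by omega) rfl]
        exact key _ _ (by omega) (by omega) (by omega) (by omega) (by omega) (by omega)

end Owner

end DecFamily

end Summit.ValiantsHypothesis.ValiantsHypothesis.Theorems.BarrierLever.AnchoredPeeling
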